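import Summits.KontsevichZagierPeriods.Zeta5Search.Families.CellularEightMiddleWeights
import Summits.KontsevichZagierPeriods.Zeta5Search.Families.CellularBrownZudilin

/-!
# Brown8 / XStarOrbitCoverA — the symmetry cover of BZ's live cone, kernel-checked (part 1: unfolding lemmas, pieces 0–14)

systematic search; no irrationality claim unless certified.

This file set PROVES the two `@[conjecture]`-tagged nodes of
`Summits/KontsevichZagierPeriods/Zeta5Search/Families/CellularEightMiddleWeights.lean`
(fam-brown8 gen 3, census/mw; status there: THEOREM-BY-COMPUTATION resp. OBSERVED):

* `xStarOrbitCover_holds : XStarOrbitCover` — every live convergent integer exponent vector `a` of BZ's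
  8-term cellular family (`BrownZudilin2022.Converges a ∧ LiveBZ a`) is carried by a word `w` in the five typed
  generators `i₁, p₀₁, p₁₂, h, h'` (`applyGen 0…4`), with EVERY intermediate vector convergent
  (`ConvergentChain w a`), to a vector inside the `X*`-region (`PolarWithinXStar (applyWord w a)`);
* `xStarOrbitCoverG_holds : XStarOrbitCoverG` — the group-element form (from the chain form by the tree's
  `xStarOrbitCoverG_of_chain`);
* `liveBZ_zeta3Free_of` — the typed CAPSTONE of the census/mw argument, CONDITIONAL on its two analytic inputs taken as
  hypotheses: BZ's invariance (27) per generator on common convergence domains (`BrownZudilin2022.invariance_of_converges'`,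
  a named Literature fact) and the ζ(3)-free law on the `X*`-region (`BZXStarZeta3Free`, conjecture-tagged node resting on
  [Brown2016, Cor. 8.2] + the computed `gr^W_6 = 0`) ⟹ for EVERY live convergent `a`,
  `I(a) ∈ ℚ·(2ζ(5)+4ζ(3)ζ(2)) + ℚ·ζ(2) + ℚ` ('ζ(3) drops out' on the whole live cone without BZ's explicit decomposition (4)).

Net effect on the tree: two conjecture-tagged nodes become theorems (the `@[conjecture]` attribute on the two `def`s is
now historical; the defs are unchanged).  What this does NOT say: nothing about irrationality; `BZXStarZeta3Free` itself is
NOT proved here (it stays conjecture-tagged); the cover is the combinatorial half of the census/mw argument, and the capstone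
only makes the dependence on the two analytic inputs explicit and kernel-checked.

## Proof structure (generated, then kernel-checked; the generator is not trusted)

An exact polyhedral cover found by a depth-first containment/splitting search over the Chvátal–Gomory-primitive rows
of the typed statement (17 convergence forms `≥ 0`, 20 `σ_F` rows `≤ -1`; targets: the convergence rows of every
prefix image and the 14 outside-`X*` rows of the final image), re-implemented statically from the tree text
(fam-brown8 g10, `pub-zeta5-fam-brown8/g10/{forms,xlp,group,cover,gen_lean}.py`; exact rational simplex / Farkas
alternatives; 64 nodes = 39 certified pieces + 24 case splits + 1 empty piece; 19 words of
length ≤ 4; search time < 30 s).  Each piece is ONE theorem `XStarCover.node_<k>` whose hypotheses are `Converges a`,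
`LiveBZ a` and the case literals of its branch (hypotheses a proof does not use carry a leading `_`); a certified piece names
its word and is closed by `omega` after unfolding; a split piece is a `by_cases` cascade over the (at most three) target rows
that can fail on it, handing each failing case to a child piece.  `omega` re-derives every containment inside the kernel, so
the Python search is evidence of nothing — only of where to look.  The pieces are spread over the files
`Brown8/XStarOrbitCoverA.lean`, `…B.lean`, … (children before parents, each file importing the previous one); the statements proper
are in `Brown8/XStarOrbitCover.lean`.  Imports: `Families/CellularEightMiddleWeights` (the statements) and
`Families/CellularBrownZudilin` (only for its unfolding lemma `converges_iff`).
-/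

namespace Summit.KontsevichZagierPeriods.Zeta5Search.Families.Cellular

open Literature.NumberTheory.Irrationality
open Literature.NumberTheory.Irrationality.BrownZudilin2022
open Literature.NumberTheory.Transcendental (zetaValue)

namespace XStarCover

/-! ### Unfolding lemmas -/

/-- `applyGen 0 = i₁`. -/
theorem applyGen_0 (a : Fin 8 → ℤ) : applyGen 0 a = genI1 a := rfl
/-- `applyGen 1 = p₀₁`. -/
theorem applyGen_1 (a : Fin 8 → ℤ) : applyGen 1 a = genP01 a := rfl
/-- `applyGen 2 = p₁₂`. -/
theorem applyGen_2 (a : Fin 8 → ℤ) : applyGen 2 a = genP12 a := rfl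
/-- `applyGen 3 = h`. -/
theorem applyGen_3 (a : Fin 8 → ℤ) : applyGen 3 a = genH a := rfl
/-- `applyGen 4 = h'`. -/
theorem applyGen_4 (a : Fin 8 → ℤ) : applyGen 4 a = genH' a := rfl

/-! `Converges b` as the conjunction of the seventeen inequalities (3) of arXiv:2210.03391 is the LANDED
`Families.Cellular.converges_iff` (`Families/CellularBrownZudilin.lean`), used by name below. -/

/-- `LiveBZ a` as the conjunction of the twenty `σ_F` conditions. -/
theorem liveBZ_iff (a : Fin 8 → ℤ) : LiveBZ a ↔
    (2 * a 1 - 2 * a 3 + 2 * a 5 - 2 * a 6 - 2 * a 7 - 2 ≤ -1 ∧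
    -2 * a 0 - 2 * a 1 + 2 * a 3 - 2 * a 5 + 2 * a 7 - 2 ≤ -1 ∧
    -2 * a 1 - 2 * a 2 - 2 * a 5 + 2 * a 6 + 2 * a 7 - 2 ≤ -1 ∧
    -2 * a 1 - 2 * a 2 + 2 * a 7 - 2 ≤ -1 ∧
    -2 * a 7 - 2 ≤ -1 ∧
    2 * a 1 + 2 * a 2 - 2 * a 3 - 2 * a 4 - 2 * a 7 - 2 ≤ -1 ∧
    2 * a 0 - 2 * a 2 - 2 * a 3 - 2 ≤ -1 ∧
    -2 * a 0 - 2 * a 6 - 2 ≤ -1 ∧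
    -2 * a 0 + 2 * a 2 - 2 * a 4 - 2 * a 5 - 2 ≤ -1 ∧
    -2 * a 1 - 2 * a 2 + 2 * a 4 - 2 ≤ -1 ∧
    -2 * a 3 - 2 * a 4 - 2 ≤ -1 ∧
    -2 * a 1 - 2 * a 2 - 2 * a 5 + 2 * a 7 - 2 ≤ -1 ∧
    -2 * a 0 - 2 * a 1 - 2 * a 4 - 2 * a 5 + 2 * a 7 - 2 ≤ -1 ∧
    -2 * a 0 + 2 * a 1 + 2 * a 2 - 2 * a 4 - 2 * a 6 - 2 * a 7 - 2 ≤ -1 ∧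
    -2 * a 3 + 2 * a 5 - 2 * a 7 - 2 ≤ -1 ∧
    -2 * a 4 - 2 * a 5 - 2 ≤ -1 ∧
    -2 * a 0 + 2 * a 2 - 2 * a 4 - 2 * a 6 - 2 ≤ -1 ∧
    -2 * a 0 - 2 * a 1 - 2 ≤ -1 ∧
    -2 * a 4 - 2 * a 5 + 2 * a 7 - 2 ≤ -1 ∧
    -2 * a 0 + 2 * a 2 + 2 * a 5 - 2 * a 6 - 2 * a 7 - 2 ≤ -1) := by
  unfold LiveBZ twoValSigmaF
  simp only [List.mem_cons, List.not_mem_nil, or_false, forall_eq_or_imp, forall_eq]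

/-- `PolarWithinXStar a` as the conjunction of the fourteen outside-`X*` conditions. -/
theorem polarWithinXStar_iff (a : Fin 8 → ℤ) : PolarWithinXStar a ↔
    (0 ≤ 2 * a 0 + 2 ∧ 0 ≤ 2 * a 1 + 2 ∧ 0 ≤ 2 * a 4 + 2 ∧ 0 ≤ 2 * a 5 + 2 ∧ 0 ≤ 2 * a 2 + 2 ∧
     0 ≤ 2 * a 0 + 2 * a 1 - 2 * a 7 + 2 ∧ 0 ≤ 2 * a 0 + 2 * a 4 + 4 ∧ 0 ≤ -2 * a 1 + 2 * a 3 + 2 * a 7 + 2 ∧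
     0 ≤ 2 * a 1 + 2 * a 4 + 2 * a 5 - 2 * a 6 - 2 * a 7 + 2 ∧ 0 ≤ -2 * a 5 + 2 * a 6 + 2 * a 7 + 2 ∧
     0 ≤ 2 * a 1 + 2 * a 5 - 2 * a 7 + 2 ∧ 0 ≤ 2 * a 1 + 2 * a 2 - 2 * a 3 + 2 * a 5 - 2 * a 7 + 2 ∧
     0 ≤ 2 * a 2 + 2 * a 5 - 2 * a 7 + 2 ∧ 0 ≤ 2 * a 0 - 2 * a 2 + 2 * a 4 + 2) := by
  unfold PolarWithinXStar twoValOutsideXStar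
  simp only [List.mem_cons, List.not_mem_nil, or_false, forall_eq_or_imp, forall_eq]

/-- The empty chain. -/
theorem convergentChain_nil (a : Fin 8 → ℤ) : ConvergentChain [] a ↔ Converges a := by
  simp [ConvergentChain, applyWord]

/-- One step of a chain: `a` converges and the rest of the word is a convergent chain from `applyGen i a`. -/
theorem convergentChain_cons (i : Fin 5) (w : List (Fin 5)) (a : Fin 8 → ℤ) :
    ConvergentChain (i :: w) a ↔ Converges a ∧ ConvergentChain w (applyGen i a) := by
  constructor
  · intro h
    refine ⟨by simpa [applyWord] using h 0 (by simp), fun k hk => ?_⟩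
    have := h (k + 1) (by simp only [List.mem_range, List.length_cons] at hk ⊢; omega)
    simpa [List.take_succ_cons, applyWord] using this
  · rintro ⟨h0, h⟩ k hk
    cases k with
    | zero => simpa [applyWord] using h0
    | succ k =>
      have := h k (by simp only [List.mem_range, List.length_cons] at hk ⊢; omega)
      simpa [List.take_succ_cons, applyWord] using this

/-! ### The pieces of the cover (generated; children before parents) -/

/-- Piece 0 (depth 6): certified for the word `[1, 0, 1]`. -/
theorem node_0 (a : Fin 8 → ℤ) (hc : Converges a) (hl : LiveBZ a)
    (s1 : 0 ≤ -a 0 - a 1 + a 7 - 2)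
    (s2 : 0 ≤ -a 0 - 2 * a 1 - a 2 + a 3 + a 4 + a 7 - 2)
    (_s3 : 0 ≤ -a 2 - a 3 + a 7 - 2)
    (s4 : 0 ≤ -a 0 - a 1 + a 5 - 2)
    (s5 : 0 ≤ -a 1 - a 4 - a 5 + a 6 + a 7 - 2)
    (s6 : 0 ≤ -a 3 + a 5 - a 6 - 2) :
    ∃ w : List (Fin 5), ConvergentChain w a ∧ PolarWithinXStar (applyWord w a) := by
  rw [converges_iff] at hc
  rw [liveBZ_iff] at hl
  refine ⟨[1, 0, 1], ?_, ?_⟩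
  · simp only [convergentChain_cons, convergentChain_nil, applyGen_0, applyGen_1, converges_iff, genI1, genP01, Matrix.cons_val]
    omega
  · simp only [applyWord, applyGen_0, applyGen_1, polarWithinXStar_iff, genI1, genP01, Matrix.cons_val]
    omega

/-- Piece 1 (depth 6): certified for the word `[0, 2, 1]`. -/
theorem node_1 (a : Fin 8 → ℤ) (hc : Converges a) (hl : LiveBZ a)
    (s1 : 0 ≤ -a 0 - a 1 + a 7 - 2)
    (s2 : 0 ≤ -a 0 - 2 * a 1 - a 2 + a 3 + a 4 + a 7 - 2)
    (s3 : 0 ≤ -a 2 - a 3 + a 7 - 2)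
    (s4 : 0 ≤ -a 0 - a 1 + a 5 - 2)
    (s5 : 0 ≤ -a 1 - a 4 - a 5 + a 6 + a 7 - 2)
    (s6 : 0 ≤ a 3 - a 5 + a 6 + 1) :
    ∃ w : List (Fin 5), ConvergentChain w a ∧ PolarWithinXStar (applyWord w a) := by
  rw [converges_iff] at hc
  rw [liveBZ_iff] at hl
  refine ⟨[0, 2, 1], ?_, ?_⟩
  · simp only [convergentChain_cons, convergentChain_nil, applyGen_0, applyGen_1, applyGen_2, converges_iff, genI1, genP01, genP12, Matrix.cons_val]
    omega
  · simp only [applyWord, applyGen_0, applyGen_1, applyGen_2, polarWithinXStar_iff, genI1, genP01, genP12, Matrix.cons_val]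
    omega

/-- Piece 2 (depth 5): case split over the 1 target row(s) of the word `[0, 2, 1]` that can fail here (each failing case is handed to a child piece); the residual case is piece 1. -/
theorem node_2 (a : Fin 8 → ℤ) (hc : Converges a) (hl : LiveBZ a)
    (s1 : 0 ≤ -a 0 - a 1 + a 7 - 2)
    (s2 : 0 ≤ -a 0 - 2 * a 1 - a 2 + a 3 + a 4 + a 7 - 2)
    (s3 : 0 ≤ -a 2 - a 3 + a 7 - 2)
    (s4 : 0 ≤ -a 0 - a 1 + a 5 - 2)
    (s5 : 0 ≤ -a 1 - a 4 - a 5 + a 6 + a 7 - 2) :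
    ∃ w : List (Fin 5), ConvergentChain w a ∧ PolarWithinXStar (applyWord w a) := by
  by_cases t1 : 0 ≤ a 3 - a 5 + a 6 + 1
  · exact node_1 a hc hl s1 s2 s3 s4 s5 t1
  · exact node_0 a hc hl s1 s2 s3 s4 s5 (by omega)

/-- Piece 3 (depth 10): certified for the word `[0, 4, 0, 3]`. -/
theorem node_3 (a : Fin 8 → ℤ) (hc : Converges a) (hl : LiveBZ a)
    (_s1 : 0 ≤ -a 0 - a 1 + a 7 - 2)
    (_s2 : 0 ≤ -a 0 - 2 * a 1 - a 2 + a 3 + a 4 + a 7 - 2)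
    (_s3 : 0 ≤ -a 2 - a 3 + a 7 - 2)
    (s4 : 0 ≤ -a 0 - a 1 + a 5 - 2)
    (s5 : 0 ≤ a 1 + a 4 + a 5 - a 6 - a 7 + 1)
    (s6 : 0 ≤ -a 1 - a 2 - a 5 + 2 * a 7 - 2)
    (s7 : 0 ≤ -a 3 + a 5 - a 6 - 2)
    (_s8 : 0 ≤ -a 1 - 2 * a 2 + a 4 + a 7 - 2)
    (s9 : 0 ≤ -a 2 - a 3 + a 5 - 2)
    (s10 : 0 ≤ -2 * a 1 - 2 * a 2 + a 3 + a 4 - a 5 + 2 * a 7 - 2)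
    (_s11 : 0 ≤ -a 0 - a 1 + a 2 + a 5 - a 7 - 2) :
    ∃ w : List (Fin 5), ConvergentChain w a ∧ PolarWithinXStar (applyWord w a) := by
  rw [converges_iff] at hc
  rw [liveBZ_iff] at hl
  refine ⟨[0, 4, 0, 3], ?_, ?_⟩
  · simp only [convergentChain_cons, convergentChain_nil, applyGen_0, applyGen_3, applyGen_4, converges_iff, genI1, genH, genH', Matrix.cons_val]
    omega
  · simp only [applyWord, applyGen_0, applyGen_3, applyGen_4, polarWithinXStar_iff, genI1, genH, genH', Matrix.cons_val]
    omega

/-- Piece 4 (depth 10): certified for the word `[3, 0, 4]`. -/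
theorem node_4 (a : Fin 8 → ℤ) (hc : Converges a) (hl : LiveBZ a)
    (_s1 : 0 ≤ -a 0 - a 1 + a 7 - 2)
    (_s2 : 0 ≤ -a 0 - 2 * a 1 - a 2 + a 3 + a 4 + a 7 - 2)
    (_s3 : 0 ≤ -a 2 - a 3 + a 7 - 2)
    (_s4 : 0 ≤ -a 0 - a 1 + a 5 - 2)
    (s5 : 0 ≤ a 1 + a 4 + a 5 - a 6 - a 7 + 1)
    (s6 : 0 ≤ -a 1 - a 2 - a 5 + 2 * a 7 - 2)
    (s7 : 0 ≤ -a 3 + a 5 - a 6 - 2)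
    (_s8 : 0 ≤ -a 1 - 2 * a 2 + a 4 + a 7 - 2)
    (_s9 : 0 ≤ -a 2 - a 3 + a 5 - 2)
    (_s10 : 0 ≤ -2 * a 1 - 2 * a 2 + a 3 + a 4 - a 5 + 2 * a 7 - 2)
    (s11 : 0 ≤ a 0 + a 1 - a 2 - a 5 + a 7 + 1) :
    ∃ w : List (Fin 5), ConvergentChain w a ∧ PolarWithinXStar (applyWord w a) := by
  rw [converges_iff] at hc
  rw [liveBZ_iff] at hl
  refine ⟨[3, 0, 4], ?_, ?_⟩
  · simp only [convergentChain_cons, convergentChain_nil, applyGen_0, applyGen_3, applyGen_4, converges_iff, genI1, genH, genH', Matrix.cons_val]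
    omega
  · simp only [applyWord, applyGen_0, applyGen_3, applyGen_4, polarWithinXStar_iff, genI1, genH, genH', Matrix.cons_val]
    omega

/-- Piece 5 (depth 9): case split over the 1 target row(s) of the word `[3, 0, 4]` that can fail here (each failing case is handed to a child piece); the residual case is piece 4. -/
theorem node_5 (a : Fin 8 → ℤ) (hc : Converges a) (hl : LiveBZ a)
    (s1 : 0 ≤ -a 0 - a 1 + a 7 - 2)
    (s2 : 0 ≤ -a 0 - 2 * a 1 - a 2 + a 3 + a 4 + a 7 - 2)
    (s3 : 0 ≤ -a 2 - a 3 + a 7 - 2)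
    (s4 : 0 ≤ -a 0 - a 1 + a 5 - 2)
    (s5 : 0 ≤ a 1 + a 4 + a 5 - a 6 - a 7 + 1)
    (s6 : 0 ≤ -a 1 - a 2 - a 5 + 2 * a 7 - 2)
    (s7 : 0 ≤ -a 3 + a 5 - a 6 - 2)
    (s8 : 0 ≤ -a 1 - 2 * a 2 + a 4 + a 7 - 2)
    (s9 : 0 ≤ -a 2 - a 3 + a 5 - 2)
    (s10 : 0 ≤ -2 * a 1 - 2 * a 2 + a 3 + a 4 - a 5 + 2 * a 7 - 2) :
    ∃ w : List (Fin 5), ConvergentChain w a ∧ PolarWithinXStar (applyWord w a) := by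
  by_cases t1 : 0 ≤ a 0 + a 1 - a 2 - a 5 + a 7 + 1
  · exact node_4 a hc hl s1 s2 s3 s4 s5 s6 s7 s8 s9 s10 t1
  · exact node_3 a hc hl s1 s2 s3 s4 s5 s6 s7 s8 s9 s10 (by omega)

/-- Piece 6 (depth 9): certified for the word `[0, 4, 0, 3]`. -/
theorem node_6 (a : Fin 8 → ℤ) (hc : Converges a) (hl : LiveBZ a)
    (_s1 : 0 ≤ -a 0 - a 1 + a 7 - 2)
    (s2 : 0 ≤ -a 0 - 2 * a 1 - a 2 + a 3 + a 4 + a 7 - 2)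
    (_s3 : 0 ≤ -a 2 - a 3 + a 7 - 2)
    (_s4 : 0 ≤ -a 0 - a 1 + a 5 - 2)
    (s5 : 0 ≤ a 1 + a 4 + a 5 - a 6 - a 7 + 1)
    (s6 : 0 ≤ -a 1 - a 2 - a 5 + 2 * a 7 - 2)
    (s7 : 0 ≤ -a 3 + a 5 - a 6 - 2)
    (s8 : 0 ≤ -a 1 - 2 * a 2 + a 4 + a 7 - 2)
    (s9 : 0 ≤ -a 2 - a 3 + a 5 - 2)
    (s10 : 0 ≤ 2 * a 1 + 2 * a 2 - a 3 - a 4 + a 5 - 2 * a 7 + 1)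
    (s11 : 0 ≤ -a 0 - 2 * a 1 + a 3 + a 4 - 2) :
    ∃ w : List (Fin 5), ConvergentChain w a ∧ PolarWithinXStar (applyWord w a) := by
  rw [converges_iff] at hc
  rw [liveBZ_iff] at hl
  refine ⟨[0, 4, 0, 3], ?_, ?_⟩
  · simp only [convergentChain_cons, convergentChain_nil, applyGen_0, applyGen_3, applyGen_4, converges_iff, genI1, genH, genH', Matrix.cons_val]
    omega
  · simp only [applyWord, applyGen_0, applyGen_3, applyGen_4, polarWithinXStar_iff, genI1, genH, genH', Matrix.cons_val]
    omega

/-- Piece 7 (depth 9): certified for the word `[1, 0, 4]`. -/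
theorem node_7 (a : Fin 8 → ℤ) (hc : Converges a) (hl : LiveBZ a)
    (_s1 : 0 ≤ -a 0 - a 1 + a 7 - 2)
    (_s2 : 0 ≤ -a 0 - 2 * a 1 - a 2 + a 3 + a 4 + a 7 - 2)
    (_s3 : 0 ≤ -a 2 - a 3 + a 7 - 2)
    (_s4 : 0 ≤ -a 0 - a 1 + a 5 - 2)
    (s5 : 0 ≤ a 1 + a 4 + a 5 - a 6 - a 7 + 1)
    (s6 : 0 ≤ -a 1 - a 2 - a 5 + 2 * a 7 - 2)
    (s7 : 0 ≤ -a 3 + a 5 - a 6 - 2)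
    (_s8 : 0 ≤ -a 1 - 2 * a 2 + a 4 + a 7 - 2)
    (_s9 : 0 ≤ -a 2 - a 3 + a 5 - 2)
    (s10 : 0 ≤ 2 * a 1 + 2 * a 2 - a 3 - a 4 + a 5 - 2 * a 7 + 1)
    (s11 : 0 ≤ a 0 + 2 * a 1 - a 3 - a 4 + 1) :
    ∃ w : List (Fin 5), ConvergentChain w a ∧ PolarWithinXStar (applyWord w a) := by
  rw [converges_iff] at hc
  rw [liveBZ_iff] at hl
  refine ⟨[1, 0, 4], ?_, ?_⟩
  · simp only [convergentChain_cons, convergentChain_nil, applyGen_0, applyGen_1, applyGen_4, converges_iff, genI1, genP01, genH', Matrix.cons_val]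
    omega
  · simp only [applyWord, applyGen_0, applyGen_1, applyGen_4, polarWithinXStar_iff, genI1, genP01, genH', Matrix.cons_val]
    omega

/-- Piece 8 (depth 8): case split over the 2 target row(s) of the word `[1, 0, 4]` that can fail here (each failing case is handed to a child piece); the residual case is piece 7. -/
theorem node_8 (a : Fin 8 → ℤ) (hc : Converges a) (hl : LiveBZ a)
    (s1 : 0 ≤ -a 0 - a 1 + a 7 - 2)
    (s2 : 0 ≤ -a 0 - 2 * a 1 - a 2 + a 3 + a 4 + a 7 - 2)
    (s3 : 0 ≤ -a 2 - a 3 + a 7 - 2)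
    (s4 : 0 ≤ -a 0 - a 1 + a 5 - 2)
    (s5 : 0 ≤ a 1 + a 4 + a 5 - a 6 - a 7 + 1)
    (s6 : 0 ≤ -a 1 - a 2 - a 5 + 2 * a 7 - 2)
    (s7 : 0 ≤ -a 3 + a 5 - a 6 - 2)
    (s8 : 0 ≤ -a 1 - 2 * a 2 + a 4 + a 7 - 2)
    (s9 : 0 ≤ -a 2 - a 3 + a 5 - 2) :
    ∃ w : List (Fin 5), ConvergentChain w a ∧ PolarWithinXStar (applyWord w a) := by
  by_cases t1 : 0 ≤ 2 * a 1 + 2 * a 2 - a 3 - a 4 + a 5 - 2 * a 7 + 1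
  · by_cases t2 : 0 ≤ a 0 + 2 * a 1 - a 3 - a 4 + 1
    · exact node_7 a hc hl s1 s2 s3 s4 s5 s6 s7 s8 s9 t1 t2
    · exact node_6 a hc hl s1 s2 s3 s4 s5 s6 s7 s8 s9 t1 (by omega)
  · exact node_5 a hc hl s1 s2 s3 s4 s5 s6 s7 s8 s9 (by omega)

/-- Piece 9 (depth 8): certified for the word `[3, 0, 1]`. -/
theorem node_9 (a : Fin 8 → ℤ) (hc : Converges a) (hl : LiveBZ a)
    (s1 : 0 ≤ -a 0 - a 1 + a 7 - 2)
    (s2 : 0 ≤ -a 0 - 2 * a 1 - a 2 + a 3 + a 4 + a 7 - 2)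
    (_s3 : 0 ≤ -a 2 - a 3 + a 7 - 2)
    (_s4 : 0 ≤ -a 0 - a 1 + a 5 - 2)
    (_s5 : 0 ≤ a 1 + a 4 + a 5 - a 6 - a 7 + 1)
    (s6 : 0 ≤ -a 1 - a 2 - a 5 + 2 * a 7 - 2)
    (s7 : 0 ≤ -a 3 + a 5 - a 6 - 2)
    (_s8 : 0 ≤ -a 1 - 2 * a 2 + a 4 + a 7 - 2)
    (s9 : 0 ≤ a 2 + a 3 - a 5 + 1) :
    ∃ w : List (Fin 5), ConvergentChain w a ∧ PolarWithinXStar (applyWord w a) := by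
  rw [converges_iff] at hc
  rw [liveBZ_iff] at hl
  refine ⟨[3, 0, 1], ?_, ?_⟩
  · simp only [convergentChain_cons, convergentChain_nil, applyGen_0, applyGen_1, applyGen_3, converges_iff, genI1, genP01, genH, Matrix.cons_val]
    omega
  · simp only [applyWord, applyGen_0, applyGen_1, applyGen_3, polarWithinXStar_iff, genI1, genP01, genH, Matrix.cons_val]
    omega

/-- Piece 10 (depth 7): case split over the 1 target row(s) of the word `[3, 0, 1]` that can fail here (each failing case is handed to a child piece); the residual case is piece 9. -/
theorem node_10 (a : Fin 8 → ℤ) (hc : Converges a) (hl : LiveBZ a)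
    (s1 : 0 ≤ -a 0 - a 1 + a 7 - 2)
    (s2 : 0 ≤ -a 0 - 2 * a 1 - a 2 + a 3 + a 4 + a 7 - 2)
    (s3 : 0 ≤ -a 2 - a 3 + a 7 - 2)
    (s4 : 0 ≤ -a 0 - a 1 + a 5 - 2)
    (s5 : 0 ≤ a 1 + a 4 + a 5 - a 6 - a 7 + 1)
    (s6 : 0 ≤ -a 1 - a 2 - a 5 + 2 * a 7 - 2)
    (s7 : 0 ≤ -a 3 + a 5 - a 6 - 2)
    (s8 : 0 ≤ -a 1 - 2 * a 2 + a 4 + a 7 - 2) :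
    ∃ w : List (Fin 5), ConvergentChain w a ∧ PolarWithinXStar (applyWord w a) := by
  by_cases t1 : 0 ≤ a 2 + a 3 - a 5 + 1
  · exact node_9 a hc hl s1 s2 s3 s4 s5 s6 s7 s8 t1
  · exact node_8 a hc hl s1 s2 s3 s4 s5 s6 s7 s8 (by omega)

/-- Piece 11 (depth 7): certified for the word `[1, 0, 1]`. -/
theorem node_11 (a : Fin 8 → ℤ) (hc : Converges a) (hl : LiveBZ a)
    (s1 : 0 ≤ -a 0 - a 1 + a 7 - 2)
    (_s2 : 0 ≤ -a 0 - 2 * a 1 - a 2 + a 3 + a 4 + a 7 - 2)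
    (_s3 : 0 ≤ -a 2 - a 3 + a 7 - 2)
    (s4 : 0 ≤ -a 0 - a 1 + a 5 - 2)
    (s5 : 0 ≤ a 1 + a 4 + a 5 - a 6 - a 7 + 1)
    (_s6 : 0 ≤ -a 1 - a 2 - a 5 + 2 * a 7 - 2)
    (s7 : 0 ≤ -a 3 + a 5 - a 6 - 2)
    (s8 : 0 ≤ a 1 + 2 * a 2 - a 4 - a 7 + 1) :
    ∃ w : List (Fin 5), ConvergentChain w a ∧ PolarWithinXStar (applyWord w a) := by
  rw [converges_iff] at hc
  rw [liveBZ_iff] at hl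
  refine ⟨[1, 0, 1], ?_, ?_⟩
  · simp only [convergentChain_cons, convergentChain_nil, applyGen_0, applyGen_1, converges_iff, genI1, genP01, Matrix.cons_val]
    omega
  · simp only [applyWord, applyGen_0, applyGen_1, polarWithinXStar_iff, genI1, genP01, Matrix.cons_val]
    omega

/-- Piece 12 (depth 6): case split over the 1 target row(s) of the word `[1, 0, 1]` that can fail here (each failing case is handed to a child piece); the residual case is piece 11. -/
theorem node_12 (a : Fin 8 → ℤ) (hc : Converges a) (hl : LiveBZ a)
    (s1 : 0 ≤ -a 0 - a 1 + a 7 - 2)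
    (s2 : 0 ≤ -a 0 - 2 * a 1 - a 2 + a 3 + a 4 + a 7 - 2)
    (s3 : 0 ≤ -a 2 - a 3 + a 7 - 2)
    (s4 : 0 ≤ -a 0 - a 1 + a 5 - 2)
    (s5 : 0 ≤ a 1 + a 4 + a 5 - a 6 - a 7 + 1)
    (s6 : 0 ≤ -a 1 - a 2 - a 5 + 2 * a 7 - 2)
    (s7 : 0 ≤ -a 3 + a 5 - a 6 - 2) :
    ∃ w : List (Fin 5), ConvergentChain w a ∧ PolarWithinXStar (applyWord w a) := by
  by_cases t1 : 0 ≤ a 1 + 2 * a 2 - a 4 - a 7 + 1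
  · exact node_11 a hc hl s1 s2 s3 s4 s5 s6 s7 t1
  · exact node_10 a hc hl s1 s2 s3 s4 s5 s6 s7 (by omega)

/-- Piece 13 (depth 6): certified for the word `[0, 2, 1]`. -/
theorem node_13 (a : Fin 8 → ℤ) (hc : Converges a) (hl : LiveBZ a)
    (s1 : 0 ≤ -a 0 - a 1 + a 7 - 2)
    (_s2 : 0 ≤ -a 0 - 2 * a 1 - a 2 + a 3 + a 4 + a 7 - 2)
    (_s3 : 0 ≤ -a 2 - a 3 + a 7 - 2)
    (s4 : 0 ≤ -a 0 - a 1 + a 5 - 2)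
    (s5 : 0 ≤ a 1 + a 4 + a 5 - a 6 - a 7 + 1)
    (s6 : 0 ≤ -a 1 - a 2 - a 5 + 2 * a 7 - 2)
    (s7 : 0 ≤ a 3 - a 5 + a 6 + 1) :
    ∃ w : List (Fin 5), ConvergentChain w a ∧ PolarWithinXStar (applyWord w a) := by
  rw [converges_iff] at hc
  rw [liveBZ_iff] at hl
  refine ⟨[0, 2, 1], ?_, ?_⟩
  · simp only [convergentChain_cons, convergentChain_nil, applyGen_0, applyGen_1, applyGen_2, converges_iff, genI1, genP01, genP12, Matrix.cons_val]
    omega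
  · simp only [applyWord, applyGen_0, applyGen_1, applyGen_2, polarWithinXStar_iff, genI1, genP01, genP12, Matrix.cons_val]
    omega

/-- Piece 14 (depth 5): case split over the 1 target row(s) of the word `[0, 2, 1]` that can fail here (each failing case is handed to a child piece); the residual case is piece 13. -/
theorem node_14 (a : Fin 8 → ℤ) (hc : Converges a) (hl : LiveBZ a)
    (s1 : 0 ≤ -a 0 - a 1 + a 7 - 2)
    (s2 : 0 ≤ -a 0 - 2 * a 1 - a 2 + a 3 + a 4 + a 7 - 2)
    (s3 : 0 ≤ -a 2 - a 3 + a 7 - 2)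
    (s4 : 0 ≤ -a 0 - a 1 + a 5 - 2)
    (s5 : 0 ≤ a 1 + a 4 + a 5 - a 6 - a 7 + 1)
    (s6 : 0 ≤ -a 1 - a 2 - a 5 + 2 * a 7 - 2) :
    ∃ w : List (Fin 5), ConvergentChain w a ∧ PolarWithinXStar (applyWord w a) := by
  by_cases t1 : 0 ≤ a 3 - a 5 + a 6 + 1
  · exact node_13 a hc hl s1 s2 s3 s4 s5 s6 t1
  · exact node_12 a hc hl s1 s2 s3 s4 s5 s6 (by omega)

end XStarCover

end Summit.KontsevichZagierPeriods.Zeta5Search.Families.Cellular
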